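import Summits.QuantumFields.YangMills.Theorems.UnitScaleTiltHistoryTailHistSum
import Summits.QuantumFields.YangMills.Theorems.UnitScaleTiltHistoryTailTowerReach
import Summits.QuantumFields.YangMills.Theorems.AlphaInputsT3ACv2RecHistories

/-!
# Route `UnitScaleTilt` — crux K2-L `HistoryTailL` (stmt-QuantumFields-19936), registered line v5p3, STUB 4a `stub_historyMassBound` — PROVED MODULO THE
# LANE'S WEIGHT CLAUSES (e′) «∫ wt(r, ·) ≤ Bm, integrable» and (e″) «Pint(r, ·) measurable» (lead finding F-g3-3: on the floored datum (e′) fails to be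
# K-uniform; it holds on the windowed twin): the history mass bound `Integrable G ∧ ∫ G ≤ e^{CM·x_j·N_j³}`,
# `G = Σ_{r ≠ triv} wt(r,·)·exp(Pint(r,·) − Σ_{i<j} #P_i(r)·σ(i,j))`, from `PintSize`, the a.e. admissible support, (e′), (e″) and the history entropy
# `Σ_h Π_i t_i^{#P_i(h)} ≤ exp(Σ_i t_i|Plaq_i|)` with `t_i = e^{−σ(i,j)} ≤ (2L³)^{−(j−i)}` (support file)

Fleet lead `ym-ust-18916-p1` (gen 3), 2026-08-27. [cite: Balaban1985UV3, (41) p.266 and (46) p.267]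
-/

noncomputable section

open scoped BigOperators

namespace Summit.QuantumFields.YangMills.Theorems.HistoryTailHistoryMass

open MeasureTheory
open Literature.MathematicalPhysics.QuantumFieldTheory.Balaban1983to89
open Literature.MathematicalPhysics.QuantumFieldTheory.Balaban1983to89.T3ContinuumYM3Torus
open Literature.MathematicalPhysics.QuantumFieldTheory.Balaban1983to89.T3UnitScaleTilt
open Literature.MathematicalPhysics.QuantumFieldTheory.Balaban1983to89.T3AlphaInputsAC
open B10LargeField (xlog)
open Summit.QuantumFields.Balaban3D.Carriers
open Summit.QuantumFields.Balaban3D.Proofs.Primitives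
open Summit.QuantumFields.Balaban3D.Proofs.HistCount (card_plaq_eq card_pairs_lt_of_d_eq_three card_site_scale)
open Summit.QuantumFields.YangMills.Theorems
open Summit.QuantumFields.YangMills.Theorems.HistoryTailTowerReach (xlog_coupling_eq one_le_xlog_coupling)
open Summit.QuantumFields.YangMills.Theorems.HistoryTailHistSum (sum_hist_prod_pow_card_le_exp)
open Classical

/-- **THE HISTORY ENTROPY AT THE STUB'S SHARES**: with `t_i = exp(−σ(i,j))`, `σ(i,j) ≥ (j − i)·(3 log L + log 2)`, the plaquette counts
`|Plaq_i| = 3·L^{3(j−i)}·N_j³` (d = 3) give `Σ_{i<j} t_i·|Plaq_i| ≤ 3·N_j³`. [cite: Balaban1985UV3, (41) p.266] -/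
theorem entropy_sum_le (F : T3Family) (K j : ℕ) (hjK : j ≤ K) (t : Fin j → ℝ)
    (ht : ∀ i : Fin j, t i ≤ Real.exp (-(((j - i : ℕ) : ℝ) * (3 * Real.log (F.L : ℝ) + Real.log 2)))) :
    ∑ i : Fin j, t i * (Fintype.card (Plaq (F.P K) i) : ℝ) ≤ 3 * ((F.P K).sitesPerDir j : ℝ) ^ 3 := by
  have hd : (F.P K).d = 3 := rfl
  have hjm : j ≤ (F.P K).m + (F.P K).K := by show j ≤ F.m + K; omega
  have hL : (0 : ℝ) < (F.L : ℝ) := by exact_mod_cast (zero_lt_one.trans F.hL.2)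
  have hsite : (Fintype.card (Site (F.P K) j) : ℝ) = ((F.P K).sitesPerDir j : ℝ) ^ 3 := by
    have : Fintype.card (Site (F.P K) j) = (F.P K).sitesPerDir j ^ (F.P K).d := by
      show Fintype.card (Fin (F.P K).d → ZMod ((F.P K).sitesPerDir j)) = _
      rw [Fintype.card_pi, Finset.prod_const, ZMod.card, Finset.card_univ, Fintype.card_fin]
    rw [this, hd]; push_cast; ring
  have hcard : ∀ i : Fin j, (Fintype.card (Plaq (F.P K) i) : ℝ) = 3 * (F.L : ℝ) ^ (3 * (j - i)) * ((F.P K).sitesPerDir j : ℝ) ^ 3 := by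
    intro i
    rw [card_plaq_eq, card_pairs_lt_of_d_eq_three hd, card_site_scale (P := F.P K) (le_of_lt i.2) hjm, ← hsite, hd]
    push_cast; rw [show ((F.P K).L : ℝ) = (F.L : ℝ) from rfl]; ring
  have hterm : ∀ i : Fin j, t i * (Fintype.card (Plaq (F.P K) i) : ℝ) ≤ 3 * ((F.P K).sitesPerDir j : ℝ) ^ 3 * (1 / 2) ^ (j - i : ℕ) := by
    intro i
    rw [hcard i]
    have hN : (0 : ℝ) ≤ 3 * ((F.P K).sitesPerDir j : ℝ) ^ 3 := by positivity
    have hpow : t i * (F.L : ℝ) ^ (3 * (j - i)) ≤ (1 / 2) ^ (j - i : ℕ) := by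
      have h1 : (F.L : ℝ) ^ (3 * (j - i)) = Real.exp (((j - i : ℕ) : ℝ) * (3 * Real.log (F.L : ℝ))) := by
        rw [← Real.exp_log (pow_pos hL _), Real.log_pow]; push_cast; ring_nf
      have h2 : ((1 : ℝ) / 2) ^ (j - i : ℕ) = Real.exp (-(((j - i : ℕ) : ℝ) * Real.log 2)) := by
        rw [← Real.exp_log (by positivity : (0 : ℝ) < (1 / 2) ^ (j - i : ℕ)), Real.log_pow, Real.log_div one_ne_zero two_ne_zero,
          Real.log_one]; ring_nf
      rw [h1, h2]
      calc t i * Real.exp (((j - i : ℕ) : ℝ) * (3 * Real.log (F.L : ℝ)))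
          ≤ Real.exp (-(((j - i : ℕ) : ℝ) * (3 * Real.log (F.L : ℝ) + Real.log 2))) * Real.exp (((j - i : ℕ) : ℝ) * (3 * Real.log (F.L : ℝ))) :=
            mul_le_mul_of_nonneg_right (ht i) (Real.exp_nonneg _)
        _ = Real.exp (-(((j - i : ℕ) : ℝ) * Real.log 2)) := by rw [← Real.exp_add]; ring_nf
    calc t i * (3 * (F.L : ℝ) ^ (3 * (j - i)) * ((F.P K).sitesPerDir j : ℝ) ^ 3)
        = 3 * ((F.P K).sitesPerDir j : ℝ) ^ 3 * (t i * (F.L : ℝ) ^ (3 * (j - i))) := by ring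
      _ ≤ 3 * ((F.P K).sitesPerDir j : ℝ) ^ 3 * (1 / 2) ^ (j - i : ℕ) := mul_le_mul_of_nonneg_left hpow hN
  have hgeom : ∑ i : Fin j, ((1 : ℝ) / 2) ^ (j - i : ℕ) ≤ 1 := by
    have h1 : ∑ i : Fin j, ((1 : ℝ) / 2) ^ (j - i : ℕ) = ∑ n ∈ Finset.range j, ((1 : ℝ) / 2) ^ (n + 1) := by
      rw [Finset.sum_range_reflect (fun n => ((1:ℝ)/2) ^ (n + 1)) j |>.symm, ← Fin.sum_univ_eq_sum_range]
      refine Finset.sum_congr rfl fun i _ => ?_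
      congr 1; have := i.2; omega
    rw [h1]
    have h2 : ∑ n ∈ Finset.range j, ((1 : ℝ) / 2) ^ (n + 1) = (1 / 2) * ∑ n ∈ Finset.range j, ((1 : ℝ) / 2) ^ n := by
      rw [Finset.mul_sum]; refine Finset.sum_congr rfl fun n _ => ?_; ring
    rw [h2]
    have h3 := geom_sum_Ico_le_of_lt_one (show (0 : ℝ) ≤ 1 / 2 by norm_num) (show (1 : ℝ) / 2 < 1 by norm_num) (m := 0) (n := j)
    rw [show Finset.Ico 0 j = Finset.range j from by ext n; simp] at h3
    have h4 : ∑ n ∈ Finset.range j, ((1 : ℝ) / 2) ^ n ≤ 2 := h3.trans (by norm_num)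
    linarith
  calc ∑ i : Fin j, t i * (Fintype.card (Plaq (F.P K) i) : ℝ) ≤ ∑ i : Fin j, 3 * ((F.P K).sitesPerDir j : ℝ) ^ 3 * (1 / 2) ^ (j - i : ℕ) :=
        Finset.sum_le_sum fun i _ => hterm i
    _ = 3 * ((F.P K).sitesPerDir j : ℝ) ^ 3 * ∑ i : Fin j, ((1 : ℝ) / 2) ^ (j - i : ℕ) := by rw [Finset.mul_sum]
    _ ≤ 3 * ((F.P K).sitesPerDir j : ℝ) ^ 3 * 1 := mul_le_mul_of_nonneg_left hgeom (by positivity)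
    _ = 3 * ((F.P K).sitesPerDir j : ℝ) ^ 3 := mul_one _

/-- **STUB 4a `stub_historyMassBound` MODULO THE WEIGHT CLAUSES (e′) (mass integrals `≤ Bm`, integrable) and (e″) (`Pint(r,·)` measurable)** — the
v5p3 text with the two clauses as extra hypotheses (to be discharged by the lane on the windowed twin, F-g3-3): for `γ ≤ γa(L, 𝔠)`,
`Integrable G ∧ ∫ G ≤ e^{(CP + 3 + Bm)·x_j·N_j³}`. [cite: Balaban1985UV3, (41) p.266 and (46) p.267] -/
theorem historyMassBound_of_massIntegral :
    ∀ (L : ℕ), Odd L → 7 ≤ L →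
      ∀ (𝔠 : AlphaConsts L (suGroupModel 2).N) (a₀ a₁ : ℝ), 0 < a₀ → 0 < a₁ → 𝔠.B₃ * a₁ ≤ a₀ →
        ∀ (CP : ℝ), 0 ≤ CP → ∀ (Bm : ℝ), 0 ≤ Bm → ∃ (CM γa : ℝ), 0 ≤ CM ∧ 0 < γa ∧
          ∀ (F : T3Family) (hF : F.L = L) (h : AlphaInputsT3AC.OfV2At F (hF ▸ 𝔠) a₀ a₁)
            (hc : 0 < a₀ ∧ 0 < a₁ ∧ (hF ▸ 𝔠).B₃ * a₁ ≤ a₀) (γ : ℝ) (hγ : 0 < γ) (hγ1 : γ ≤ (min (hF ▸ 𝔠).gamma0 1) ^ 2)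
            (π : AlphaInputsT3AC.PolymerT3 F), γ ≤ γa →
            PintSize (h.dataT3c hc γ hγ hγ1 π) (hF ▸ 𝔠).b₀ (hF ▸ 𝔠).p₀ CP →
            (∀ (K j : ℕ) (r : (h.lfDataT3c hc γ hγ hγ1 π).Reg K j) (v : (i : Fin j) → GaugeField (F.P K) i (Matrix.specialUnitaryGroup (Fin 2) ℂ)),
              j ≤ K → r ≠ (h.lfDataT3c hc γ hγ hγ1 π).trivReg K j →
                ∀ᵐ Wf ∂fieldMeasure (F.P K) j (Matrix.specialUnitaryGroup (Fin 2) ℂ),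
                  (h.lfDataT3c hc γ hγ hγ1 π).wt K j r v Wf ≠ 0 →
                    (h.dataT3c hc γ hγ hγ1 π).Adm K j ((h.lfDataT3c hc γ hγ hγ1 π).assemble K j r v) Wf) →
            (∀ (K j : ℕ) (r : (h.lfDataT3c hc γ hγ hγ1 π).Reg K j) (v : (i : Fin j) → GaugeField (F.P K) i (Matrix.specialUnitaryGroup (Fin 2) ℂ)),
              j ≤ K → Integrable ((h.lfDataT3c hc γ hγ hγ1 π).wt K j r v) (fieldMeasure (F.P K) j (Matrix.specialUnitaryGroup (Fin 2) ℂ)) ∧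
                ∫ Wf, (h.lfDataT3c hc γ hγ hγ1 π).wt K j r v Wf ∂fieldMeasure (F.P K) j (Matrix.specialUnitaryGroup (Fin 2) ℂ) ≤ Bm) →
            (∀ (K j : ℕ) (r : (h.lfDataT3c hc γ hγ hγ1 π).Reg K j) (v : (i : Fin j) → GaugeField (F.P K) i (Matrix.specialUnitaryGroup (Fin 2) ℂ)),
              j ≤ K → Measurable fun Wf : GaugeField (F.P K) j (Matrix.specialUnitaryGroup (Fin 2) ℂ) =>
                (h.dataT3c hc γ hγ hγ1 π).Pint K j ((h.lfDataT3c hc γ hγ hγ1 π).assemble K j r v) Wf) →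
            ∀ (K j : ℕ), j ≤ K → ∀ (v : (i : Fin j) → GaugeField (F.P K) i (Matrix.specialUnitaryGroup (Fin 2) ℂ)),
              Integrable (fun Wf : GaugeField (F.P K) j (Matrix.specialUnitaryGroup (Fin 2) ℂ) =>
                ∑ r ∈ Finset.univ.erase (Summit.QuantumFields.Balaban3D.Carriers.Hist.triv (F.P K) j),
                  (h.lfDataT3c hc γ hγ hγ1 π).wt K j r v Wf *
                    Real.exp ((h.dataT3c hc γ hγ hγ1 π).Pint K j ((h.lfDataT3c hc γ hγ hγ1 π).assemble K j r v) Wf -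
                      ∑ i ∈ Finset.range j, (((h.lfDataT3c hc γ hγ hγ1 π).LargeP K j r i).card : ℝ) *
                        ((hF ▸ 𝔠).b₀ ^ 2 / 200 *
                          (1 + Real.log (Real.sqrt (γ * ((F.L : ℝ)⁻¹) ^ (K - i)))⁻¹) ^ (2 * (hF ▸ 𝔠).p₀ - 1) *
                          ((1 + Real.log (Real.sqrt (γ * ((F.L : ℝ)⁻¹) ^ (K - i)))⁻¹) -
                            (1 + Real.log (Real.sqrt (γ * ((F.L : ℝ)⁻¹) ^ (K - j)))⁻¹)))))
                (fieldMeasure (F.P K) j (Matrix.specialUnitaryGroup (Fin 2) ℂ)) ∧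
              ∫ Wf, ∑ r ∈ Finset.univ.erase (Summit.QuantumFields.Balaban3D.Carriers.Hist.triv (F.P K) j),
                  (h.lfDataT3c hc γ hγ hγ1 π).wt K j r v Wf *
                    Real.exp ((h.dataT3c hc γ hγ hγ1 π).Pint K j ((h.lfDataT3c hc γ hγ hγ1 π).assemble K j r v) Wf -
                      ∑ i ∈ Finset.range j, (((h.lfDataT3c hc γ hγ hγ1 π).LargeP K j r i).card : ℝ) *
                        ((hF ▸ 𝔠).b₀ ^ 2 / 200 *
                          (1 + Real.log (Real.sqrt (γ * ((F.L : ℝ)⁻¹) ^ (K - i)))⁻¹) ^ (2 * (hF ▸ 𝔠).p₀ - 1) *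
                          ((1 + Real.log (Real.sqrt (γ * ((F.L : ℝ)⁻¹) ^ (K - i)))⁻¹) -
                            (1 + Real.log (Real.sqrt (γ * ((F.L : ℝ)⁻¹) ^ (K - j)))⁻¹))))
                  ∂fieldMeasure (F.P K) j (Matrix.specialUnitaryGroup (Fin 2) ℂ) ≤
                Real.exp (CM * (1 + Real.log (Real.sqrt (γ * ((F.L : ℝ)⁻¹) ^ (K - j)))⁻¹) * ((F.P K).sitesPerDir j : ℝ) ^ 3) := by
  intro L hLo h7 𝔠 a₀ a₁ ha0 ha1 hw CP hCP Bm hBm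
  have hL1 : 1 < L := by omega
  obtain ⟨γθ, hγθ, hγθ1, hθle⟩ := T3Thresholds.exists_gamma_forall_θBal_le 𝔠.b₀_pos 𝔠.p₀_pos one_pos
  set lg : ℝ := Real.log (Real.sqrt (L : ℝ)) with hlg
  have hlg0 : 0 < lg := by
    rw [hlg]; refine Real.log_pos ?_; rw [show (1 : ℝ) = Real.sqrt 1 from Real.sqrt_one.symm]
    exact Real.sqrt_lt_sqrt zero_le_one (by exact_mod_cast (by omega : 1 < L))
  set X₁ : ℝ := max 1 (200 * (6 * lg + Real.log 2) / (𝔠.b₀ ^ 2 * lg)) with hX₁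
  set γa : ℝ := min γθ (min 1 (Real.exp (-(2 * (X₁ - 1))))) with hγa
  refine ⟨CP + 3 + Bm, γa, by positivity, by rw [hγa]; positivity, ?_⟩
  intro F hF h hc γ hγ hγ1 π hγa' hPS hAdm hmass hPm K j hjK v
  subst hF
  have hγ1' : γ ≤ 1 := hγa'.trans ((min_le_right _ _).trans (min_le_left _ _))
  have hγθ' : γ ≤ γθ := hγa'.trans (min_le_left _ _)
  have hγe : γ ≤ Real.exp (-(2 * (X₁ - 1))) := hγa'.trans ((min_le_right _ _).trans (min_le_right _ _))
  have hFL1 : (1 : ℝ) ≤ (F.L : ℝ) := by exact_mod_cast F.hL.2.le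
  set μ := fieldMeasure (F.P K) j (Matrix.specialUnitaryGroup (Fin 2) ℂ) with hμ
  set xf : ℕ → ℝ := fun i => xlog (Real.sqrt (γ * ((F.L : ℝ)⁻¹) ^ (K - i))) with hxf
  have hxf_eq : ∀ i, 1 + Real.log (Real.sqrt (γ * ((F.L : ℝ)⁻¹) ^ (K - i)))⁻¹ = xf i := fun i => rfl
  have hx1 : ∀ i, 1 ≤ xf i := fun i => one_le_xlog_coupling hγ hγ1' hFL1 (K - i)
  have hxmono : ∀ i l, i ≤ l → l ≤ K → xf i = xf l + (l - i : ℕ) * lg := by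
    intro i l hil hlK
    have := xlog_coupling_eq hγ (by linarith : (0 : ℝ) < F.L) hil hlK (K := K)
    rw [hxf]; simp only []; rw [this, hlg]
  set N : ℝ := ((F.P K).sitesPerDir j : ℝ) with hN
  have hN1 : 1 ≤ N := by rw [hN]; exact_mod_cast Nat.one_le_iff_ne_zero.mpr ((F.P K).sitesPerDir_ne_zero j)
  set σ : ℕ → ℝ := fun i => 𝔠.b₀ ^ 2 / 200 * xf i ^ (2 * 𝔠.p₀ - 1) * (xf i - xf j) with hσ
  set triv := Summit.QuantumFields.Balaban3D.Carriers.Hist.triv (F.P K) j with htriv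
  -- the terms
  set c : Hist (F.P K) j → ℝ := fun r => ∑ i ∈ Finset.range j, (((h.lfDataT3c hc γ hγ hγ1 π).LargeP K j r i).card : ℝ) * σ i with hc'
  set f : Hist (F.P K) j → GaugeField (F.P K) j (Matrix.specialUnitaryGroup (Fin 2) ℂ) → ℝ := fun r Wf =>
    (h.lfDataT3c hc γ hγ hγ1 π).wt K j r v Wf * Real.exp ((h.dataT3c hc γ hγ hγ1 π).Pint K j r Wf - c r) with hf
  have hwt0 : ∀ r Wf, 0 ≤ (h.lfDataT3c hc γ hγ hγ1 π).wt K j r v Wf := fun r Wf => (h.dataT3c_lfSum hc γ hγ hγ1 π).1 K j r v Wf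
  -- Pint on the admissible support: `Pint ≤ CP·x_j·N³`
  have hPle : ∀ r Wf, 1 ≤ j → (h.dataT3c hc γ hγ hγ1 π).Adm K j r Wf → (h.dataT3c hc γ hγ hγ1 π).Pint K j r Wf ≤ CP * (xf j * N ^ 3) := by
    intro r Wf hj1 hadm
    have h1 := (abs_le.mp (hPS K j r Wf hjK hj1 hadm)).2
    have hθ1 : θBal F.L γ 𝔠.b₀ 𝔠.p₀ (K - j + 1) ≤ 1 := hθle F.L F.hL.2.le γ hγ hγθ' (K - j + 1)
    have hθ0 : 0 ≤ θBal F.L γ 𝔠.b₀ 𝔠.p₀ (K - j + 1) :=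
      (T3MinimiserStabilityReduction.θBal_pos F.hL.2.le hγ hγ1' 𝔠.b₀_pos 𝔠.p₀ (K - j + 1)).le
    have hsq : θBal F.L γ 𝔠.b₀ 𝔠.p₀ (K - j + 1) ^ 2 ≤ 1 := pow_le_one₀ hθ0 hθ1
    have hN3 : 0 ≤ N ^ 3 := by positivity
    calc (h.dataT3c hc γ hγ hγ1 π).Pint K j r Wf ≤ CP * θBal F.L γ 𝔠.b₀ 𝔠.p₀ (K - j + 1) ^ 2 * N ^ 3 := h1
      _ ≤ CP * 1 * N ^ 3 := by gcongr
      _ ≤ CP * (xf j * N ^ 3) := by rw [mul_one]; exact mul_le_mul_of_nonneg_left (le_mul_of_one_le_left hN3 (hx1 j)) hCP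
  -- per-term a.e. bound, integrability and integral
  set A₀ : ℝ := Real.exp (CP * (xf j * N ^ 3)) with hA₀
  have hterm : ∀ r, r ≠ triv → Integrable (f r) μ ∧ ∫ Wf, f r Wf ∂μ ≤ A₀ * Real.exp (-c r) * Bm := by
    intro r hr
    have hj1 : 1 ≤ j := by
      rcases Nat.eq_zero_or_pos j with h0 | hpos
      · subst h0; exact absurd (Subsingleton.elim r triv) hr
      · exact hpos
    obtain ⟨hwI, hwB⟩ := hmass K j r v hjK
    have hae : ∀ᵐ Wf ∂μ, ‖f r Wf‖ ≤ A₀ * Real.exp (-c r) * (h.lfDataT3c hc γ hγ hγ1 π).wt K j r v Wf := by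
      filter_upwards [hAdm K j r v hjK hr] with Wf hWf
      rw [Real.norm_eq_abs, hf]; simp only []
      by_cases hw : (h.lfDataT3c hc γ hγ hγ1 π).wt K j r v Wf = 0
      · rw [hw, zero_mul, abs_zero, mul_zero]
      · have hadm := hWf hw
        have hP := hPle r Wf hj1 hadm
        rw [abs_of_nonneg (mul_nonneg (hwt0 r Wf) (Real.exp_nonneg _))]
        have hexp : Real.exp ((h.dataT3c hc γ hγ hγ1 π).Pint K j r Wf - c r) ≤ A₀ * Real.exp (-c r) := by
          rw [hA₀, ← Real.exp_add]; exact Real.exp_le_exp.mpr (by linarith)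
        calc (h.lfDataT3c hc γ hγ hγ1 π).wt K j r v Wf * Real.exp ((h.dataT3c hc γ hγ hγ1 π).Pint K j r Wf - c r)
            ≤ (h.lfDataT3c hc γ hγ hγ1 π).wt K j r v Wf * (A₀ * Real.exp (-c r)) := mul_le_mul_of_nonneg_left hexp (hwt0 r Wf)
          _ = A₀ * Real.exp (-c r) * (h.lfDataT3c hc γ hγ hγ1 π).wt K j r v Wf := by ring
    have hmeas : AEStronglyMeasurable (f r) μ := by
      rw [hf]
      exact hwI.aestronglyMeasurable.mul (((hPm K j r v hjK).sub_const (c r)).exp.aestronglyMeasurable)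
    have hI : Integrable (f r) μ := (hwI.const_mul (A₀ * Real.exp (-c r))).mono' hmeas hae
    refine ⟨hI, ?_⟩
    calc ∫ Wf, f r Wf ∂μ ≤ ∫ Wf, A₀ * Real.exp (-c r) * (h.lfDataT3c hc γ hγ hγ1 π).wt K j r v Wf ∂μ :=
          integral_mono_ae hI (hwI.const_mul _) (hae.mono fun Wf hWf => (le_abs_self _).trans (Real.norm_eq_abs _ ▸ hWf))
      _ = A₀ * Real.exp (-c r) * ∫ Wf, (h.lfDataT3c hc γ hγ hγ1 π).wt K j r v Wf ∂μ := integral_const_mul _ _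
      _ ≤ A₀ * Real.exp (-c r) * Bm := mul_le_mul_of_nonneg_left hwB (by positivity)
  -- the shares dominate `(j − i)(3 log L + log 2)`
  have hxK : X₁ ≤ xf j := by
    have h1 : xf K ≤ xf j := by
      have h0 : (0 : ℝ) ≤ ((K - j : ℕ) : ℝ) * lg := mul_nonneg (Nat.cast_nonneg _) hlg0.le
      rw [hxmono j K hjK le_rfl]; linarith
    have h2 : X₁ ≤ xf K := by
      have hlog : Real.log γ ≤ -(2 * (X₁ - 1)) := (Real.log_le_iff_le_exp hγ).mpr hγe
      have hK : xf K = 1 - Real.log γ / 2 := by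
        rw [hxf]; simp only [Nat.sub_self, pow_zero, mul_one, xlog]; rw [Real.log_inv, Real.log_sqrt hγ.le]; ring
      rw [hK]; linarith
    exact h2.trans h1
  have hlgL : 6 * lg = 3 * Real.log (F.L : ℝ) := by
    rw [hlg, Real.log_sqrt (by positivity)]; ring
  set t : Fin j → ℝ := fun i => Real.exp (-σ i) with ht
  have htle : ∀ i : Fin j, t i ≤ Real.exp (-(((j - i : ℕ) : ℝ) * (3 * Real.log (F.L : ℝ) + Real.log 2))) := by
    intro i
    rw [ht]; simp only []
    refine Real.exp_le_exp.mpr (neg_le_neg ?_)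
    have hi : (i : ℕ) ≤ j := le_of_lt i.2
    have hxij : xf i = xf j + (j - i : ℕ) * lg := hxmono i j hi hjK
    have hn0 : (0 : ℝ) ≤ ((j - i : ℕ) : ℝ) := Nat.cast_nonneg _
    have hxi1 : 1 ≤ xf i := hx1 i
    have hp1 : (1 : ℝ) ≤ 2 * 𝔠.p₀ - 1 := by have := 𝔠.two_lt_p₀; linarith
    have hxpow : xf j ≤ xf i ^ (2 * 𝔠.p₀ - 1) := by
      calc xf j ≤ xf i := by rw [hxij]; nlinarith
        _ = xf i ^ (1 : ℝ) := (Real.rpow_one _).symm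
        _ ≤ xf i ^ (2 * 𝔠.p₀ - 1) := Real.rpow_le_rpow_of_exponent_le hxi1 hp1
    have hb : 0 < 𝔠.b₀ ^ 2 := by have := 𝔠.b₀_pos; positivity
    have hX : 200 * (6 * lg + Real.log 2) / (𝔠.b₀ ^ 2 * lg) ≤ xf i ^ (2 * 𝔠.p₀ - 1) := ((le_max_right _ _).trans hxK).trans hxpow
    have hX' : 200 * (6 * lg + Real.log 2) ≤ xf i ^ (2 * 𝔠.p₀ - 1) * (𝔠.b₀ ^ 2 * lg) := (div_le_iff₀ (by positivity)).mp hX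
    rw [← hlgL, hσ]; simp only []
    have hdiff : xf i - xf j = ((j - i : ℕ) : ℝ) * lg := by rw [hxij]; ring
    rw [hdiff]
    -- `(j-i)(6lg + log 2) ≤ (b₀²/200)·x_i^{2p₀−1}·((j−i)lg)`
    have := mul_le_mul_of_nonneg_left hX' hn0
    calc ((j - i : ℕ) : ℝ) * (6 * lg + Real.log 2) = (1 / 200) * (((j - i : ℕ) : ℝ) * (200 * (6 * lg + Real.log 2))) := by ring
      _ ≤ (1 / 200) * (((j - i : ℕ) : ℝ) * (xf i ^ (2 * 𝔠.p₀ - 1) * (𝔠.b₀ ^ 2 * lg))) := mul_le_mul_of_nonneg_left this (by norm_num)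
      _ = 𝔠.b₀ ^ 2 / 200 * xf i ^ (2 * 𝔠.p₀ - 1) * (((j - i : ℕ) : ℝ) * lg) := by ring
  -- the per-history bound, including inadmissible histories (whose weight vanishes identically)
  have hbound : ∀ r, r ≠ triv → Integrable (f r) μ ∧ ∫ Wf, f r Wf ∂μ ≤ A₀ * Bm * ∏ i : Fin j, t i ^ (r i).card := by
    intro r hr
    obtain ⟨hI, hle⟩ := hterm r hr
    refine ⟨hI, ?_⟩
    by_cases hra : Hist.Admissible 𝔠.lane.carrier.M₁ (rcolOf (T3Scales F γ hγ (hγ1.trans (sq_min_one_le _ 𝔠.gamma0_pos)) K) 𝔠.lane.carrier) j r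
    · have hc_eq : c r = ∑ i : Fin j, ((r i).card : ℝ) * σ i := by
        simp only [hc']
        rw [Finset.sum_range (fun i => (((h.lfDataT3c hc γ hγ hγ1 π).LargeP K j r i).card : ℝ) * σ i)]
        refine Finset.sum_congr rfl fun i _ => ?_
        rw [h.lfDataT3c_largeP_of_admissible hc γ hγ hγ1 π K j r hra i i.2]
      have hexp : Real.exp (-c r) = ∏ i : Fin j, t i ^ (r i).card := by
        rw [hc_eq, ← Finset.sum_neg_distrib, Real.exp_sum]
        refine Finset.prod_congr rfl fun i _ => ?_
        rw [ht]; simp only []; rw [← Real.exp_nat_mul]; ring_nf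
      calc ∫ Wf, f r Wf ∂μ ≤ A₀ * Real.exp (-c r) * Bm := hle
        _ = A₀ * Bm * ∏ i : Fin j, t i ^ (r i).card := by rw [hexp]; ring
    · have hzero : f r = fun _ => 0 := by
        funext Wf; rw [hf]; simp only []
        rw [h.lfDataT3c_wt_eq_zero_of_not_admissible hc γ hγ hγ1 π K j r hra v Wf, zero_mul]
      rw [hzero, integral_zero]
      exact mul_nonneg (mul_nonneg (Real.exp_nonneg _) hBm) (Finset.prod_nonneg fun i _ => pow_nonneg (Real.exp_nonneg _) _)
  -- assemble
  have hInt : Integrable (fun Wf => ∑ r ∈ Finset.univ.erase triv, f r Wf) μ :=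
    integrable_finsetSum _ fun r hr => (hbound r (Finset.ne_of_mem_erase hr)).1
  have hsum : ∫ Wf, ∑ r ∈ Finset.univ.erase triv, f r Wf ∂μ ≤ A₀ * Bm * Real.exp (3 * N ^ 3) := by
    rw [integral_finsetSum _ fun r hr => (hbound r (Finset.ne_of_mem_erase hr)).1]
    calc ∑ r ∈ Finset.univ.erase triv, ∫ Wf, f r Wf ∂μ ≤ ∑ r ∈ Finset.univ.erase triv, A₀ * Bm * ∏ i : Fin j, t i ^ (r i).card :=
          Finset.sum_le_sum fun r hr => (hbound r (Finset.ne_of_mem_erase hr)).2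
      _ ≤ ∑ r : Hist (F.P K) j, A₀ * Bm * ∏ i : Fin j, t i ^ (r i).card :=
          Finset.sum_le_sum_of_subset_of_nonneg (Finset.erase_subset _ _) fun r _ _ =>
            mul_nonneg (mul_nonneg (Real.exp_nonneg _) hBm) (Finset.prod_nonneg fun i _ => pow_nonneg (Real.exp_nonneg _) _)
      _ = A₀ * Bm * ∑ r : Hist (F.P K) j, ∏ i : Fin j, t i ^ (r i).card := by rw [Finset.mul_sum]
      _ ≤ A₀ * Bm * Real.exp (∑ i : Fin j, t i * (Fintype.card (Plaq (F.P K) i) : ℝ)) :=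
          mul_le_mul_of_nonneg_left (sum_hist_prod_pow_card_le_exp j t fun i => (Real.exp_nonneg _)) (mul_nonneg (Real.exp_nonneg _) hBm)
      _ ≤ A₀ * Bm * Real.exp (3 * N ^ 3) :=
          mul_le_mul_of_nonneg_left (Real.exp_le_exp.mpr (entropy_sum_le F K j hjK t htle)) (mul_nonneg (Real.exp_nonneg _) hBm)
  have hfinal : A₀ * Bm * Real.exp (3 * N ^ 3) ≤ Real.exp ((CP + 3 + Bm) * xf j * N ^ 3) := by
    have hxN : 1 ≤ xf j * N ^ 3 := one_le_mul_of_one_le_of_one_le (hx1 j) (one_le_pow₀ hN1)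
    have hB : Bm ≤ Real.exp (Bm * (xf j * N ^ 3)) := by
      calc Bm ≤ Bm + 1 := by linarith
        _ ≤ Real.exp Bm := Real.add_one_le_exp Bm
        _ ≤ Real.exp (Bm * (xf j * N ^ 3)) := Real.exp_le_exp.mpr (by nlinarith)
    have h3 : Real.exp (3 * N ^ 3) ≤ Real.exp (3 * (xf j * N ^ 3)) :=
      Real.exp_le_exp.mpr (by nlinarith [hx1 j, show (0:ℝ) ≤ N ^ 3 by positivity])
    calc A₀ * Bm * Real.exp (3 * N ^ 3) ≤ A₀ * Real.exp (Bm * (xf j * N ^ 3)) * Real.exp (3 * (xf j * N ^ 3)) :=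
          mul_le_mul (mul_le_mul_of_nonneg_left hB (Real.exp_nonneg _)) h3 (Real.exp_nonneg _) (by positivity)
      _ = Real.exp ((CP + 3 + Bm) * xf j * N ^ 3) := by rw [hA₀, ← Real.exp_add, ← Real.exp_add]; ring_nf
  exact ⟨hInt, hsum.trans hfinal⟩

end Summit.QuantumFields.YangMills.Theorems.HistoryTailHistoryMass

end
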